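import Mathlib

/-!
# LEMMA Z of the `a = 3` residual blueprint for `LaplaceOptimal 5`: full support ⇒ vanishing `3 × 3` permanents force
# vanishing `2 × 2` permanents (crux `RankRigidMinimalRepr`, stmt-ValiantsHypothesis-18034; frontier rung `LaplaceOptimalFive`, stmt-24813)

FILE 1 of the successor plan recorded by val-lit-p8 g11 (evidence note `NOTE-p8g11-24813-a3-class-residual4.md` §v3 on
stmt-24813, «What remains formal: lemma Z»; val-lit desk RULING #258 (a); seat val-port-2 of the val-lit port pool).  Setting
of `…LaplaceResidualTools` (p614067): three covectors `φ₀ φ₁ φ₂ : Fin 5 → ℂ` (the first three slots of the dual witness).  Write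
`P(a,b) = φ₁(a) φ₂(b) + φ₁(b) φ₂(a)` for the `2 × 2` permanent of `(φ₁; φ₂)` on the letters `a ≠ b` and
`per₃(a,b,c) = φ₀(a) P(b,c) + φ₀(b) P(a,c) + φ₀(c) P(a,b)` for the `3 × 3` permanent of `(φ₀; φ₁; φ₂)` on the letters
`a, b, c` (Laplace expansion along `φ₀`).  Everything is spelled out; the file declares no definition.

* `six_mul_pairPerm_eq_combination` — the DIVISION-FREE INVERSION IDENTITY behind the invertibility of the `10 × 10`
  pairs-versus-triples inclusion matrix `W = W_{2,3}(5)` (its inverse is `⅓·[|P∩T|=2] − ⅙·[|P∩T|=1] + ⅓·[|P∩T|=0]`):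
  `6 · φ₀(2)φ₀(3)φ₀(4) · P(0,1) = Σ_T c_T · φ₀^{[5]∖T} · per₃(T)` with `c_T = 2, −1, 2` according as `|T ∩ {0,1}| = 2, 1, 0`
  — a polynomial identity (`ring`), no non-vanishing needed.
* `pairPerm_zero_one_eq_zero` — hence, if every `φ₀(c) ≠ 0` and all ten `per₃` vanish, `P(0,1) = 0`.
* **`pairPerm_eq_zero_of_triplePerm_eq_zero` (LEMMA Z)** — the same for EVERY pair `a ≠ b`, by relabelling the letters with
  a permutation `σ` of `Fin 5` with `σ 0 = a`, `σ 1 = b` (`exists_perm_apply_zero_one`).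
* `pairPerm_eq_zero_of_triplePerm_eq_zero'` — the conclusion with all ten hypotheses packaged as one `∀`-statement over
  ordered distinct triples, the form the two-slot expansion `LaplaceResidual.permanent_two_slot` feeds (its fibre sum
  `M₀₁₂(x,y)`, `x ≠ y`, is `per₃` on the three letters `≠ x, y`; that identification is FILE 2's first lemma).
Use in the blueprint (Case 1): the first covector `φ₀` has full support, so the linear map `φ₂ ↦ (per₃(T))_T` has kernel
`{φ₂ : P(φ₁, φ₂) = 0}`, of dimension `≤ 1` (`offdiag_ne_zero_of_support_three`, `…LaplaceSupportCore`).
HONEST FRAMING: an elementary linear-algebra helper toward the frontier rung `LaplaceOptimalFive` (stmt-24813), which stays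
OPEN (as does 24814 and the crux 18034); nothing here bears on `VP ≠ VNP`. [folklore; the inclusion-matrix inverse is the
Johnson-scheme / Gottlieb–Kantor computation, done here by hand]
-/

set_option autoImplicit false

-- the mandated summit-side namespace repeats a component by design (single-problem summit)
set_option linter.dupNamespace false

namespace Summit.ValiantsHypothesis.ValiantsHypothesis.Theorems.RigidityForcesSymmetryRankRigidMinimalRepr

namespace LaplaceResidual

open Finset

/-! ### §1 The inversion identity for the pair `{0,1}` -/

/-- **Inversion identity (pair `{0,1}`).**  With `P(a,b) = φ₁ a φ₂ b + φ₁ b φ₂ a` and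
`per₃(a,b,c) = φ₀ a · P(b,c) + φ₀ b · P(a,c) + φ₀ c · P(a,b)`:
`6 φ₀(2)φ₀(3)φ₀(4) · P(0,1) = Σ_T c_T φ₀^{[5]∖T} per₃(T)`, `c_T = 2 / −1 / 2` for `|T ∩ {0,1}| = 2 / 1 / 0` — the row of
`W_{2,3}(5)⁻¹ = ⅓[|P∩T|=2] − ⅙[|P∩T|=1] + ⅓[|P∩T|=0]` at the pair `{0,1}`, cleared of denominators.  A polynomial identity.
[folklore] -/
theorem six_mul_pairPerm_eq_combination (φ₀ φ₁ φ₂ : Fin 5 → ℂ) :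
    6 * (φ₀ 2 * φ₀ 3 * φ₀ 4) * (φ₁ 0 * φ₂ 1 + φ₁ 1 * φ₂ 0) =
      (2 * φ₀ 3 * φ₀ 4) *
          (φ₀ 0 * (φ₁ 1 * φ₂ 2 + φ₁ 2 * φ₂ 1) + φ₀ 1 * (φ₁ 0 * φ₂ 2 + φ₁ 2 * φ₂ 0) + φ₀ 2 * (φ₁ 0 * φ₂ 1 + φ₁ 1 * φ₂ 0)) +
      (2 * φ₀ 2 * φ₀ 4) *
          (φ₀ 0 * (φ₁ 1 * φ₂ 3 + φ₁ 3 * φ₂ 1) + φ₀ 1 * (φ₁ 0 * φ₂ 3 + φ₁ 3 * φ₂ 0) + φ₀ 3 * (φ₁ 0 * φ₂ 1 + φ₁ 1 * φ₂ 0)) +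
      (2 * φ₀ 2 * φ₀ 3) *
          (φ₀ 0 * (φ₁ 1 * φ₂ 4 + φ₁ 4 * φ₂ 1) + φ₀ 1 * (φ₁ 0 * φ₂ 4 + φ₁ 4 * φ₂ 0) + φ₀ 4 * (φ₁ 0 * φ₂ 1 + φ₁ 1 * φ₂ 0)) +
      (-1 * φ₀ 1 * φ₀ 4) *
          (φ₀ 0 * (φ₁ 2 * φ₂ 3 + φ₁ 3 * φ₂ 2) + φ₀ 2 * (φ₁ 0 * φ₂ 3 + φ₁ 3 * φ₂ 0) + φ₀ 3 * (φ₁ 0 * φ₂ 2 + φ₁ 2 * φ₂ 0)) +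
      (-1 * φ₀ 1 * φ₀ 3) *
          (φ₀ 0 * (φ₁ 2 * φ₂ 4 + φ₁ 4 * φ₂ 2) + φ₀ 2 * (φ₁ 0 * φ₂ 4 + φ₁ 4 * φ₂ 0) + φ₀ 4 * (φ₁ 0 * φ₂ 2 + φ₁ 2 * φ₂ 0)) +
      (-1 * φ₀ 1 * φ₀ 2) *
          (φ₀ 0 * (φ₁ 3 * φ₂ 4 + φ₁ 4 * φ₂ 3) + φ₀ 3 * (φ₁ 0 * φ₂ 4 + φ₁ 4 * φ₂ 0) + φ₀ 4 * (φ₁ 0 * φ₂ 3 + φ₁ 3 * φ₂ 0)) +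
      (-1 * φ₀ 0 * φ₀ 4) *
          (φ₀ 1 * (φ₁ 2 * φ₂ 3 + φ₁ 3 * φ₂ 2) + φ₀ 2 * (φ₁ 1 * φ₂ 3 + φ₁ 3 * φ₂ 1) + φ₀ 3 * (φ₁ 1 * φ₂ 2 + φ₁ 2 * φ₂ 1)) +
      (-1 * φ₀ 0 * φ₀ 3) *
          (φ₀ 1 * (φ₁ 2 * φ₂ 4 + φ₁ 4 * φ₂ 2) + φ₀ 2 * (φ₁ 1 * φ₂ 4 + φ₁ 4 * φ₂ 1) + φ₀ 4 * (φ₁ 1 * φ₂ 2 + φ₁ 2 * φ₂ 1)) +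
      (-1 * φ₀ 0 * φ₀ 2) *
          (φ₀ 1 * (φ₁ 3 * φ₂ 4 + φ₁ 4 * φ₂ 3) + φ₀ 3 * (φ₁ 1 * φ₂ 4 + φ₁ 4 * φ₂ 1) + φ₀ 4 * (φ₁ 1 * φ₂ 3 + φ₁ 3 * φ₂ 1)) +
      (2 * φ₀ 0 * φ₀ 1) *
          (φ₀ 2 * (φ₁ 3 * φ₂ 4 + φ₁ 4 * φ₂ 3) + φ₀ 3 * (φ₁ 2 * φ₂ 4 + φ₁ 4 * φ₂ 2) + φ₀ 4 * (φ₁ 2 * φ₂ 3 + φ₁ 3 * φ₂ 2)) := by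
  ring

/-- The pair `{0,1}`: if every coordinate of `φ₀` is non-zero and the ten `3 × 3` permanents
`per₃(a,b,c) = φ₀ a (φ₁ b φ₂ c + φ₁ c φ₂ b) + φ₀ b (φ₁ a φ₂ c + φ₁ c φ₂ a) + φ₀ c (φ₁ a φ₂ b + φ₁ b φ₂ a)` of `(φ₀;φ₁;φ₂)` vanish
on all triples of distinct letters, then `φ₁ 0 φ₂ 1 + φ₁ 1 φ₂ 0 = 0`. [folklore] -/
theorem pairPerm_zero_one_eq_zero (φ₀ φ₁ φ₂ : Fin 5 → ℂ) (h0 : ∀ c, φ₀ c ≠ 0)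
    (hper : ∀ a b c : Fin 5, a ≠ b → a ≠ c → b ≠ c →
      φ₀ a * (φ₁ b * φ₂ c + φ₁ c * φ₂ b) + φ₀ b * (φ₁ a * φ₂ c + φ₁ c * φ₂ a) +
        φ₀ c * (φ₁ a * φ₂ b + φ₁ b * φ₂ a) = 0) :
    φ₁ 0 * φ₂ 1 + φ₁ 1 * φ₂ 0 = 0 := by
  have h012 := hper 0 1 2 (by decide) (by decide) (by decide)
  have h013 := hper 0 1 3 (by decide) (by decide) (by decide)
  have h014 := hper 0 1 4 (by decide) (by decide) (by decide)
  have h023 := hper 0 2 3 (by decide) (by decide) (by decide)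
  have h024 := hper 0 2 4 (by decide) (by decide) (by decide)
  have h034 := hper 0 3 4 (by decide) (by decide) (by decide)
  have h123 := hper 1 2 3 (by decide) (by decide) (by decide)
  have h124 := hper 1 2 4 (by decide) (by decide) (by decide)
  have h134 := hper 1 3 4 (by decide) (by decide) (by decide)
  have h234 := hper 2 3 4 (by decide) (by decide) (by decide)
  have key : 6 * (φ₀ 2 * φ₀ 3 * φ₀ 4) * (φ₁ 0 * φ₂ 1 + φ₁ 1 * φ₂ 0) = 0 := by
    rw [six_mul_pairPerm_eq_combination]
    linear_combination (2 * φ₀ 3 * φ₀ 4) * h012 + (2 * φ₀ 2 * φ₀ 4) * h013 + (2 * φ₀ 2 * φ₀ 3) * h014 +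
      (-1 * φ₀ 1 * φ₀ 4) * h023 + (-1 * φ₀ 1 * φ₀ 3) * h024 + (-1 * φ₀ 1 * φ₀ 2) * h034 +
      (-1 * φ₀ 0 * φ₀ 4) * h123 + (-1 * φ₀ 0 * φ₀ 3) * h124 + (-1 * φ₀ 0 * φ₀ 2) * h134 +
      (2 * φ₀ 0 * φ₀ 1) * h234
  have hne : (6 : ℂ) * (φ₀ 2 * φ₀ 3 * φ₀ 4) ≠ 0 :=
    mul_ne_zero (by norm_num) (mul_ne_zero (mul_ne_zero (h0 2) (h0 3)) (h0 4))
  rcases mul_eq_zero.1 key with h | h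
  · exact absurd h hne
  · exact h

/-! ### §2 Relabelling: every pair -/

/-- For distinct letters `a ≠ b` of `Fin 5` there is a permutation `σ` with `σ 0 = a` and `σ 1 = b`
(two transpositions). [folklore] -/
theorem exists_perm_apply_zero_one (a b : Fin 5) (hab : a ≠ b) :
    ∃ σ : Equiv.Perm (Fin 5), σ 0 = a ∧ σ 1 = b := by
  classical
  set τ : Equiv.Perm (Fin 5) := Equiv.swap 0 a with hτ
  set b' : Fin 5 := τ b with hb'
  have hb'0 : b' ≠ 0 := by
    intro h
    have : τ (τ b) = τ 0 := by rw [← hb', h]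
    rw [hτ, Equiv.swap_apply_self, Equiv.swap_apply_left] at this
    exact hab this.symm
  refine ⟨(Equiv.swap (1 : Fin 5) b').trans τ, ?_, ?_⟩
  · have h1 : Equiv.swap (1 : Fin 5) b' 0 = 0 := Equiv.swap_apply_of_ne_of_ne (by decide) hb'0.symm
    rw [Equiv.trans_apply, h1, hτ, Equiv.swap_apply_left]
  · rw [Equiv.trans_apply, Equiv.swap_apply_left, hb', hτ, Equiv.swap_apply_self]

/-- **LEMMA Z (full-support lemma).**  Let `φ₀ φ₁ φ₂ : Fin 5 → ℂ` with every `φ₀ c ≠ 0`.  If all `3 × 3` permanents of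
`(φ₀; φ₁; φ₂)` on triples of distinct letters vanish —
`φ₀ a (φ₁ b φ₂ c + φ₁ c φ₂ b) + φ₀ b (φ₁ a φ₂ c + φ₁ c φ₂ a) + φ₀ c (φ₁ a φ₂ b + φ₁ b φ₂ a) = 0` — then all `2 × 2` permanents
of `(φ₁; φ₂)` vanish: `φ₁ a φ₂ b + φ₁ b φ₂ a = 0` for `a ≠ b`.  (The `10 × 10` pairs–triples inclusion matrix is invertible;
pair `{0,1}` by `pairPerm_zero_one_eq_zero`, the general pair by relabelling.) [folklore] -/
theorem pairPerm_eq_zero_of_triplePerm_eq_zero (φ₀ φ₁ φ₂ : Fin 5 → ℂ) (h0 : ∀ c, φ₀ c ≠ 0)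
    (hper : ∀ a b c : Fin 5, a ≠ b → a ≠ c → b ≠ c →
      φ₀ a * (φ₁ b * φ₂ c + φ₁ c * φ₂ b) + φ₀ b * (φ₁ a * φ₂ c + φ₁ c * φ₂ a) +
        φ₀ c * (φ₁ a * φ₂ b + φ₁ b * φ₂ a) = 0)
    (a b : Fin 5) (hab : a ≠ b) : φ₁ a * φ₂ b + φ₁ b * φ₂ a = 0 := by
  obtain ⟨σ, hσ0, hσ1⟩ := exists_perm_apply_zero_one a b hab
  have h := pairPerm_zero_one_eq_zero (φ₀ ∘ σ) (φ₁ ∘ σ) (φ₂ ∘ σ) (fun c => h0 (σ c))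
    (fun x y z hxy hxz hyz =>
      hper (σ x) (σ y) (σ z) (σ.injective.ne hxy) (σ.injective.ne hxz) (σ.injective.ne hyz))
  simpa only [Function.comp_apply, hσ0, hσ1] using h

/-- LEMMA Z with the hypotheses and conclusions indexed by ORDERED distinct letters, as `Fin 5`-quantified statements
(the shape consumed with `LaplaceResidual.permanent_two_slot`: its fibre sum `M₀₁₂(x,y)`, `x ≠ y`, is the `3 × 3` permanent
of `(φ₀;φ₁;φ₂)` on the letters `≠ x, y`). [folklore] -/
theorem pairPerm_eq_zero_of_triplePerm_eq_zero' (φ₀ φ₁ φ₂ : Fin 5 → ℂ) (h0 : ∀ c, φ₀ c ≠ 0)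
    (hper : ∀ a b c : Fin 5, a ≠ b → a ≠ c → b ≠ c →
      φ₀ a * (φ₁ b * φ₂ c + φ₁ c * φ₂ b) + φ₀ b * (φ₁ a * φ₂ c + φ₁ c * φ₂ a) +
        φ₀ c * (φ₁ a * φ₂ b + φ₁ b * φ₂ a) = 0) :
    ∀ a b : Fin 5, a ≠ b → φ₁ a * φ₂ b + φ₁ b * φ₂ a = 0 :=
  fun a b hab => pairPerm_eq_zero_of_triplePerm_eq_zero φ₀ φ₁ φ₂ h0 hper a b hab

/-- Contrapositive reading used by the blueprint: if `φ₀` has full support and SOME `2 × 2` permanent of `(φ₁;φ₂)` is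
non-zero, then SOME `3 × 3` permanent of `(φ₀;φ₁;φ₂)` is non-zero. [folklore] -/
theorem exists_triplePerm_ne_zero (φ₀ φ₁ φ₂ : Fin 5 → ℂ) (h0 : ∀ c, φ₀ c ≠ 0) {a b : Fin 5} (hab : a ≠ b)
    (hP : φ₁ a * φ₂ b + φ₁ b * φ₂ a ≠ 0) :
    ∃ x y z : Fin 5, x ≠ y ∧ x ≠ z ∧ y ≠ z ∧
      φ₀ x * (φ₁ y * φ₂ z + φ₁ z * φ₂ y) + φ₀ y * (φ₁ x * φ₂ z + φ₁ z * φ₂ x) +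
        φ₀ z * (φ₁ x * φ₂ y + φ₁ y * φ₂ x) ≠ 0 := by
  by_contra hcon
  push Not at hcon
  exact hP (pairPerm_eq_zero_of_triplePerm_eq_zero φ₀ φ₁ φ₂ h0
    (fun x y z hxy hxz hyz => hcon x y z hxy hxz hyz) a b hab)

end LaplaceResidual

end Summit.ValiantsHypothesis.ValiantsHypothesis.Theorems.RigidityForcesSymmetryRankRigidMinimalRepr
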